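import Mathlib.LinearAlgebra.FreeModule.PID
import Mathlib.LinearAlgebra.Dimension.Finrank
import Mathlib.LinearAlgebra.Dimension.OrzechProperty
import Mathlib.LinearAlgebra.FiniteDimensional.Lemmas
import Mathlib.Data.ZMod.Basic
import Mathlib.Tactic
import HarnessLib

/-!
# Crux `ThetaLayerLambdaCongruenceAtTwo` (stmt-BirchSwinnertonDyer-20688, route ResidualThetaTransportAtTwo), line
# `birth` v9, plan ITEM B1' (lead rtt-p3 g3): a sublattice of `ℤ^ι` whose reduction mod `p` has full rank is
# `p`-SATURATED (width seat bsd-wall-rtt-p3-w3 g2; `--supports stmt-BirchSwinnertonDyer-20688 --as helper`; closes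
# nothing)

HONEST FRAMING. Generic linear algebra (no definition, no instance); nothing about any curve or form is asserted; BSD is
not proved by any of this.

WHAT. The integrality step of ITEM B1' («the integral Manin-symbol / relation lattice has no `2`-torsion in its
cokernel») in the form that combines with the field-independent rank of `…QuiverCycleSpace`
(`quiver_rank_incidence_add_one` over `ℚ` and over `𝔽₂`): for a prime `p` and a subgroup `L ≤ ℤ^ι` (`ι` finite; `L` is
free, `Submodule.basisOfPid`), if the `𝔽_p`-span of the reductions mod `p` of the elements of `L` has dimension
`rank_ℤ L`, then `p·x ∈ L ⇒ x ∈ L` (`mem_of_prime_smul_mem_of_finrank_modP_eq`): reduce a `ℤ`-basis of `L`, it stays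
linearly independent mod `p`, so all coefficients of `p·x` are divisible by `p`. Only `p = 2` matters for (C3k)
(`k` of characteristic `2`: odd torsion `d·M(c) = 0` already forces `M(c) = 0`).

References: [Manin1972] Thm. 1.9 (where it is used); Wiese, Computational arithmetic of modular forms, Thm. 5.7/5.9.
-/

-- justification: the `Summit.BirchSwinnertonDyer.BirchSwinnertonDyer.…` path repeats a component (route-file convention)
set_option linter.dupNamespace false

namespace Summit.BirchSwinnertonDyer.BirchSwinnertonDyer.Theorems.ThetaLayerLambdaCongruenceAtTwo

section Saturation

variable {ι : Type*} [Fintype ι] {p : ℕ} [Fact p.Prime]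

omit [Fintype ι] in
/-- Reduction mod `p` of `ℤ^ι` is additive and `ℤ`-homogeneous (coordinatewise `Int.cast`). [folklore] -/
theorem modP_sum_smul {n : ℕ} (c : Fin n → ℤ) (v : Fin n → ι → ℤ) :
    (fun i ↦ (((∑ j, c j • v j) i : ℤ) : ZMod p)) = ∑ j, ((c j : ℤ) : ZMod p) • (fun i ↦ ((v j i : ℤ) : ZMod p)) := by
  funext i
  simp only [Finset.sum_apply, Pi.smul_apply, smul_eq_mul, Int.cast_sum, Int.cast_mul]

/-- **A sublattice of `ℤ^ι` with full rank mod `p` is `p`-saturated.** If `L ≤ ℤ^ι` and the `𝔽_p`-span of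
`{x mod p : x ∈ L}` has `𝔽_p`-dimension `rank_ℤ L`, then `p·x ∈ L ⇒ x ∈ L`. [folklore] -/
theorem mem_of_prime_smul_mem_of_finrank_modP_eq (L : Submodule ℤ (ι → ℤ))
    (h : Module.finrank (ZMod p) (Submodule.span (ZMod p)
      ((fun x : ι → ℤ ↦ (fun i ↦ ((x i : ℤ) : ZMod p))) '' (L : Set (ι → ℤ)))) = Module.finrank ℤ L)
    {x : ι → ℤ} (hx : (p : ℤ) • x ∈ L) : x ∈ L := by
  classical
  obtain ⟨n, b⟩ := Submodule.basisOfPid (Pi.basisFun ℤ ι) L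
  have hp : (p : ℤ) ≠ 0 := by exact_mod_cast (Fact.out : p.Prime).ne_zero
  -- every `y ∈ L` is `∑ c_j • b_j` in `ℤ^ι`
  have hrepr : ∀ y : L, (y : ι → ℤ) = ∑ j, (b.repr y j) • ((b j : L) : ι → ℤ) := by
    intro y
    conv_lhs => rw [← b.sum_repr y]
    rw [Submodule.coe_sum]
    rfl
  -- the span of the reductions is spanned by the reduced basis
  have hspan : Submodule.span (ZMod p) ((fun x : ι → ℤ ↦ (fun i ↦ ((x i : ℤ) : ZMod p))) '' (L : Set (ι → ℤ))) =
      Submodule.span (ZMod p) (Set.range (fun j : Fin n ↦ (fun i ↦ ((((b j : L) : ι → ℤ) i : ℤ) : ZMod p)))) := by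
    apply le_antisymm
    · rw [Submodule.span_le]
      rintro _ ⟨y, hy, rfl⟩
      have e := hrepr ⟨y, hy⟩
      simp only at e
      change (fun i ↦ ((y i : ℤ) : ZMod p)) ∈ _
      rw [show (fun i ↦ ((y i : ℤ) : ZMod p)) = fun i ↦ (((∑ j, (b.repr ⟨y, hy⟩ j) • ((b j : L) : ι → ℤ)) i : ℤ) : ZMod p)
        by rw [← e], modP_sum_smul]
      exact Submodule.sum_mem _ fun j _ ↦ Submodule.smul_mem _ _ (Submodule.subset_span ⟨j, rfl⟩)
    · rw [Submodule.span_le]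
      rintro _ ⟨j, rfl⟩
      exact Submodule.subset_span ⟨(b j : L), (b j).2, rfl⟩
  -- the reduced basis is linearly independent over `𝔽_p`
  have hli : LinearIndependent (ZMod p) (fun j : Fin n ↦ (fun i ↦ ((((b j : L) : ι → ℤ) i : ℤ) : ZMod p))) := by
    rw [linearIndependent_iff_card_eq_finrank_span, Fintype.card_fin, Set.finrank, ← hspan, h,
      Module.finrank_eq_card_basis b, Fintype.card_fin]
  -- the coefficients of `p • x` are divisible by `p`
  set c : Fin n → ℤ := fun j ↦ b.repr ⟨(p : ℤ) • x, hx⟩ j with hc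
  have hsum : (p : ℤ) • x = ∑ j, c j • ((b j : L) : ι → ℤ) := hrepr ⟨(p : ℤ) • x, hx⟩
  have hzero : ∑ j, ((c j : ℤ) : ZMod p) • (fun i ↦ ((((b j : L) : ι → ℤ) i : ℤ) : ZMod p)) = 0 := by
    rw [← modP_sum_smul, ← hsum]
    funext i
    simp only [Pi.smul_apply, smul_eq_mul, Int.cast_mul, Int.cast_natCast, ZMod.natCast_self, zero_mul,
      Pi.zero_apply]
  have hdvd : ∀ j, (p : ℤ) ∣ c j := fun j ↦ by
    have := Fintype.linearIndependent_iff.mp hli (fun j ↦ ((c j : ℤ) : ZMod p)) hzero j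
    exact (ZMod.intCast_zmod_eq_zero_iff_dvd (c j) p).mp this
  choose d hd using hdvd
  -- hence `x = ∑ d_j • b_j ∈ L`
  have hx' : x = ∑ j, d j • ((b j : L) : ι → ℤ) := by
    apply smul_right_injective (ι → ℤ) hp
    simp only
    rw [hsum, Finset.smul_sum]
    refine Finset.sum_congr rfl fun j _ ↦ ?_
    rw [hd j, mul_smul]
  rw [hx']
  exact Submodule.sum_mem _ fun j _ ↦ Submodule.smul_mem _ _ (b j).2

end Saturation

end Summit.BirchSwinnertonDyer.BirchSwinnertonDyer.Theorems.ThetaLayerLambdaCongruenceAtTwo
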